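import Literature.Computability.AlgebraicComplexity.GCT
import Literature.Computability.AlgebraicComplexity.HI16BinaryDC
import Literature.Computability.AlgebraicComplexity.QuantumFunctionalsUpper
import Literature.RepresentationTheory.GeneralLinear.SchurFunctor
import Literature.NumberTheory.DiophantineGeometry.SchurWeylPlethysm
import Mathlib.RingTheory.LaurentSeries
import Mathlib.LinearAlgebra.Matrix.Permutation
import HarnessLib

/-!
# BLMW 2011 §8–§9 as printed: Kronecker coefficients (rectangular case, constraints, the
# zero-weight-space plethysm), weakly-skew and approximate complexity classes, order of
# approximation (typed literature)

P. Bürgisser, J. M. Landsberg, L. Manivel, J. Weyman, *An overview of mathematical issues arising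
in the geometric complexity theory approach to `VP ≠ VNP`*, SIAM J. Comput. **40**(4) (2011)
1179–1209 = arXiv:0907.2850**v2** [BurgisserEtAl2011], §8 "Kronecker coefficients", §9
"Complexity classes". Cell `val-lit` (D-0074 GROUP L), row `BLMW11-B` of
`run/shared/lean/pub/val-lit/DAG.tsv`; typed literature only — **`VP ≠ VNP` is not proved and
nothing here is progress on it**; the `Prop`s named `…Question…` are OPEN QUESTIONS of the source,
stated neutrally and never asserted.

**Version of record** = arXiv v2 (SIAM numbering `\numberwithin{theorem}{subsection}`); the held
corpus text `paper:arxiv-0907.2850` (chunks `p0017`–`p0022` for §8–§9) is arXiv v1 with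
sequential numbering; locators below are "v2 number (v1 = held chunk number)". The one `prop`
environment of §8.3 prints as "Proposition 8.1" in both versions (separate counter). Sylvester's
formula is display (8.3.1) of the print (the first landing of this file tagged it "(8.3.3)";
corrected, referee ref-1 2026-08-26).

## Dictionary print ↔ tree

`k_{πμν}` = "the multiplicity of `[π]` inside `[μ] ⊗ [ν]`" (§8.1) = `kroneckerCoeff k μ ν π`
(`SymmetricGroupReps.lean`, `dim Hom_{𝔖_n}(S^μ ⊗ S^ν, S^π)`; symmetric in characteristic zero);
`δⁿ = (δ,…,δ)` (`n` parts) = `Nat.Partition.rectangle n δ`; `[π]` = `spechtRep`, `χ_π` =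
`spechtCharacter`; `S_μV` for `V = kⁿ` = `schurRep (stdRep (Fin n) k) μ` (`SchurFunctor.lean`);
"multiplicity of `S_μℂⁿ` in `S^n(S^δℂⁿ)`" = `plethysmCoeffOfPartition k n δ μ` (`SchurWeylPlethysm.lean`);
`L(f)` = the tree's `complexity` (fan-in-two straight-line circuits, `ArithCircuit.lean` — equal to
BLMW's vertex count up to a constant factor, which every statement typed here is insensitive to);
`VNP` = `IsVNPFamily`; Conjecture 1.1 [MS1] = the tree's `BorderDcPerSuperpolynomial` (`GCT.lean`);
`\overline{GL_{n²}·det_n}` = `orbitClosure (detPoly (Fin n) ℂ)`.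

## Contents (print item → declaration → status)

* (8.1.1) `k_{πμν} = (1/n!) ∑_w χ_π χ_μ χ_ν` → the tree's `kroneckerCoeff_eq_sum_spechtCharacter`
  (CITED). §8.1 "if `k_{πμν} ≠ 0` then `|π̄| ≤ |μ̄| + |ν̄|`" (Murnaghan, Brion) →
  `BLMW2011_kronecker_firstRow` (named fact; PROVED in the sibling file
  `BLMW11KroneckerConstraintsProofs.lean`, `BLMW2011_kronecker_firstRow_holds`, val-lit t02).
* §8.2 semigroup property → the tree's `kroneckerCoeff_pos_of_ofPartition_add` /
  `ikenmeyerPanova2017_semigroup_holds` (PROVED, CITED); entropy relations (8.2.2) → the tree's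
  `ChristandlVranaZuiddam2023_entropy_le_of_kroneckerCoeff` (CITED); BCI'09 on rectangular shapes →
  `BCI2011_thm1` (`NotViaSaturations.lean`, CITED). Thm. 8.2.1 (Klyachko's facets of `KRON_ℓ`)
  NOT typed (Schubert-calculus coefficients `c^w_{uv}(a,b)` absent).
* §8.3 Stanley's character formula for `χ_{δⁿ}` → `BLMW2011_stanley_rectangularCharacter` (fact;
  AS CORRECTED — ERRATUM A13: the print swaps Stanley's two bases, see the decl's docstring);
  Sylvester's formula (8.3.1) → `numPartitionsInBox`, `Nat.Partition.twoRow`,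
  `BLMW2011_sylvester` (fact, additive form); "Proposition 8.1" (the case `n = 2`) →
  `BLMW2011_prop_8_1` (fact); constraints "`H(π̃) ≤ 2 log n`", "`|π|_{>ab} ≤ δ(n-a)⁺ + δ(n-b)⁺`",
  "`|π|_{≤n} ≥ δ`" → `BLMW2011_rectangular_constraints` (fact, for `n ≥ 1` — see the ERRATUM in its
  docstring; proved as `BLMW2011_rectangular_constraints_of_pos` in
  `BLMW11KroneckerConstraintsProofs.lean`). The length-three `ST` formula and
  the invariant ring `A = Sym(U ⊗ V ⊗ W)^{SL×SL}` are NOT typed (no skew LR tableaux / invariant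
  ring vocabulary).
* §8.4 Cor. 8.4.2 (`dim ((S_μℂⁿ)_0)^{𝔖_n} = mult(S_μℂⁿ, S^n(S^δℂⁿ))`, the identification BLMW use
  for `p_μ` in Def. 5.5.1) → `zeroWeightSpace`, `permToGL`, `BLMW2011_cor_8_4_2` (fact);
  Thm. 8.4.1 (Gay: `S_π(S^δV) = ⊕_μ (S_μV)^{⊕ s_{μ,π}}`, `s_{μ,π}` the multiplicity of `[π]` in
  `(S_μV)_0`) NOT typed beyond its corollary: the general plethysm `S_π(S^δV)` is not in the tree's
  word model (`PlethysmWordModel.lean` covers `Symⁿ Symᵐ` / `Λⁿ Λᵐ` only) and the nested Schur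
  functor carrier `schurModule k (schurModule k V (δ)) π` does not carry the instances the tree's
  `hwMultiplicity` needs — recorded for the GAP-LEDGER; "for `δ` even and all `μ_i` even `S_μℂⁿ` occurs in
  `S^n(S^δℂⁿ)` [buci:10]" is PROVED in the tree (`BCI2011_evenPlethysm_holds`, CITED); (8.4.1)
  and the `N(π;n,δ)` formula NOT typed.
* §9.1 weakly-skew circuits → `ArithCircuit.IsWeaklySkew` (skew circuits are the tree's
  `ArithCircuit.IsSkew`, `HI16BinaryDC.lean`, CITED), `wsComplexity`, `skewComplexity`, `IsVPwsFamily`; "(det_n) ∈ VP_ws" (Berkowitz), "(det_n) is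
  `VP_ws`-complete" (Toda), "for each weakly-skew circuit there is a skew circuit of at most double
  size" (Kaltofen–Koiran) → `BLMW2011_sec9_detVPws` (fact, class-level statements only, which do
  not depend on the constant in the size measure).
* Def. 9.3.1 (`\underline{L}`, `\underline{L_ws}`), `\overline{VP_ws}` → `approxComplexity`,
  `approxWsComplexity`, `IsVPwsBarFamily`, `IsVPBarFamily`; Prop. 9.3.2 → `BLMW2011_prop_9_3_2`
  (fact); Remark 9.3.3 (`n = O(m²2^m)`) is superseded in the tree by Grenet's
  `determinantalComplexity_perPoly_le_holds` (`dc(per_m) ≤ 2^m - 1`) — not typed.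
* Lemma 9.4.1 (Hilbert) → `BLMW2011_lemma_9_4_1` (fact); (9.4.1) "approximated with order at most
  `q` along a curve in the orbit of `det_n`" → `IsApproxAlongOrbitOfOrder`; Question 9.4.2 →
  `BLMW2011_question_9_4_2` (OPEN QUESTION, neutral `Prop`); Prop. 9.4.3 → `BLMW2011_prop_9_4_3`
  (fact: an affirmative answer gives `VP_ws = \overline{VP_ws}`); Lemma 9.4.4 NOT typed
  (multi-output weakly-skew complexity over `ℂ[[ε]]` not in the tree).

## References

* [BurgisserEtAl2011] BLMW 2011, §8.1 (8.1.1)–(8.1.2), §8.2 Thm. 8.2.1 (8.2.2), §8.3 (8.3.1)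
  "Prop. 8.1", §8.4 Thm. 8.4.1 Cor. 8.4.2, §9.1–§9.2, Def. 9.3.1, Prop. 9.3.2, Rem. 9.3.3,
  Lemma 9.4.1, (9.4.1), Question 9.4.2, Prop. 9.4.3, Lemma 9.4.4.
* [Burgisser2004Factors] P. Bürgisser, *The complexity of factors of multivariate polynomials*,
  FoCM 4 (2004) (= [buer:03a]: approximate complexity, Thm. 5.7).
* [Kempf1978], [Klyachko2004QuantumMarginal], [BurgisserChristandlIkenmeyer2011],
  [BurgisserChristandlIkenmeyer2011Even], [MalodPortier2008], [Toda1991], [FultonHarrisGTM129].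
* [Stanley2003Rectangular] R. P. Stanley, *Irreducible symmetric group characters of rectangular
  shape*, Sém. Lothar. Combin. 50 (2003/04), Art. B50d = arXiv:math/0109093, Thm. 1 — the primary
  source of §8.3's character formula (ERRATUM A13 correction of the printed bases).
-/

noncomputable section

open MvPolynomial

namespace Literature.Computability.AlgebraicComplexity

open Literature.NumberTheory.DiophantineGeometry
open Literature.RepresentationTheory.GeneralLinear (schurRep stdRep schurModule)

/-! ### §8.1 General facts -/

section GeneralFacts

/-- **BLMW 2011 §8.1 (Murnaghan; Brion 1993):** "Write `π = (n - |π̄|, π̄)`. … if `k_{πμν} ≠ 0`,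
then `|π̄| ≤ |μ̄| + |ν̄|`" — removing the first (largest) part: `|π̄| = n - π₁`. (The sequel
"in case of equality `k_{πμν} = c^{π̄}_{μ̄,ν̄}`" is not typed: no Littlewood–Richardson coefficients in
the tree.) Named fact (D-0014), over `ℂ`. (v1: §8.1, held p0017.) [cite: BurgisserEtAl2011, §8.1] -/
def BLMW2011_kronecker_firstRow : Prop :=
  ∀ {n : ℕ} (π μ ν : Nat.Partition n), kroneckerCoeff ℂ μ ν π ≠ 0 →
    n - π.parts.sup ≤ (n - μ.parts.sup) + (n - ν.parts.sup)

end GeneralFacts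

/-! ### §8.3 Rectangular partitions -/

section Rectangular

/-- **BLMW 2011 §8.3, Stanley's character formula [Stanley 2003]** — AS PRINTED: "Suppose that
`w` is a permutation in `𝔖_{δn}`. Then `χ_{δⁿ}(w) = ((-1)^{δn} / ∏_{i=1}^{δ} ∏_{j=1}^{n} (i+j-1)) ·
∑_{uv=w} δ^{κ(u)} (-n)^{κ(v)}`, where `u, v ∈ 𝔖_{δn}` and `κ(u)` denotes the number of cycles in
`u`" (fixed points counted: `κ(u)` = the number of parts of the cycle-type partition
`Equiv.Perm.partition u`). Typed multiplied through by the (nonzero) hook product, over `ℂ`, with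
`χ_{δⁿ} = spechtCharacter ℂ (Nat.Partition.rectangle n δ)` (the partition with `n` parts equal to
`δ`). **AS CORRECTED (ERRATUM A13, cell val-lit 2026-08-26; referees ref-1 g3 / ref-3 g4, lit g3):**
the print swaps the two bases of Stanley's formula. The primary source — R. P. Stanley,
*Irreducible symmetric group characters of rectangular shape*, Sém. Lothar. Combin. **50**
(2003/04), Art. B50d, **Thm. 1** (arXiv:math/0109093, held `paper:arxiv-math_0109093`
p0002.txt:L49–L56: "`χ̂^{p×q}(μ, 1^{pq-k}) = (-1)^k ∑_{uv=w_μ} p^{κ(u)} (-q)^{κ(v)}`", where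
`p × q` is the shape with "exactly `p` parts, all equal to `q`" (p0002.txt:L9–L11) and
`χ̂^λ = (n)_k χ^λ / f^λ`, `f^λ = n!/∏ h(u)`, so that at `k = n = pq` the normalisation is the hook
product `∏_{i ≤ p, j ≤ q} (i + j - 1)`) — gives, for the shape `δⁿ = rectangle n δ` (`p = n`,
`q = δ`), the summand `n^{κ(u)} (-δ)^{κ(v)}`, which is what is typed below; the sign `(-1)^{δn}` and
the hook product are as printed. Sanity check `(n, δ) = (2, 1)`, `w` = the transposition
(`χ_{(1,1)}` = sign): LHS `= 2 · (-1) = -2`; corrected RHS `= 2²·(-1) + 2·(-1)² = -2`; the printed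
bases would give `1·(-2) + 1·(-2)² = +2`. Named fact (D-0014); the statement body was FALSE as first
typed (faithful to the misprint) and is recorded on the cell's PRINT-ERRATA list as A13.
(v1: §8.3, held p0018.) [cite: BurgisserEtAl2011, §8.3 (Stanley's character formula)]
[cite: Stanley2003Rectangular, Thm. 1] -/
def BLMW2011_stanley_rectangularCharacter : Prop :=
  ∀ (n δ : ℕ) (w : Equiv.Perm (Fin (n * δ))),
    (∏ i ∈ Finset.range δ, ∏ j ∈ Finset.range n, ((i + 1 + (j + 1) - 1 : ℕ) : ℂ)) *
        spechtCharacter ℂ (Nat.Partition.rectangle n δ) w =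
      (-1 : ℂ) ^ (δ * n) * ∑ u : Equiv.Perm (Fin (n * δ)),
        (n : ℂ) ^ (Equiv.Perm.partition u).parts.card *
          (-(δ : ℂ)) ^ (Equiv.Perm.partition (u⁻¹ * w)).parts.card

open Classical in
/-- `P(b; r × c)`: the number of partitions of `b` whose Young diagram fits inside an `r × c`
rectangle (at most `r` parts, each at most `c`). BLMW 2011 §8.3: "`P(b; δ × n)` denotes the number
of partitions of size `b` inside the rectangle `δ × n`". [cite: BurgisserEtAl2011, §8.3 (8.3.1)] -/
def numPartitionsInBox (b r c : ℕ) : ℕ :=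
  ((Finset.univ : Finset (Nat.Partition b)).filter fun p => p.parts.card ≤ r ∧ ∀ x ∈ p.parts, x ≤ c).card

/-- The two-row partition `(N - b, b)` of `N` (for `b ≤ N`; zero parts dropped, so it is `(N)` for
`b = 0`), the shape of Sylvester's formula. Declared in Mathlib's `Nat.Partition` namespace for dot
notation (deliberate extension). [cite: BurgisserEtAl2011, §8.3 (8.3.1)] -/
def _root_.Nat.Partition.twoRow (N b : ℕ) (hb : b ≤ N) : Nat.Partition N :=
  Nat.Partition.ofSums N ({N - b, b} : Multiset ℕ) (by simp [Nat.sub_add_cancel hb])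

/-- **Sylvester's formula (BLMW 2011, (8.3.1)):** "for a partition `π = (a, b)` of `δn` in two
parts, `k_{π,δⁿ,δⁿ}` is equal to the multiplicity of `S_πU` in `S^δ(S^nU)`. This is given by
Sylvester's formula `k_{(δn-b,b),δⁿ,δⁿ} = P(b; δ×n) - P(b-1; δ×n)`." Typed in the additive
(subtraction-free) form `k + P(b-1; δ×n) = P(b; δ×n)` for `1 ≤ b`, `2b ≤ δn`, together with the
case `b = 0` (`k_{(δn),δⁿ,δⁿ} = 1 = P(0; δ×n)`). Named fact (D-0014), over `ℂ`.
(v1: §8.3, held p0018.) [cite: BurgisserEtAl2011, §8.3 (8.3.1)] -/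
def BLMW2011_sylvester : Prop :=
  ∀ (n δ b : ℕ) (hb : 2 * b ≤ n * δ),
    (1 ≤ b →
      kroneckerCoeff ℂ (Nat.Partition.rectangle n δ) (Nat.Partition.rectangle n δ)
          (Nat.Partition.twoRow (n * δ) b (by omega)) + numPartitionsInBox (b - 1) δ n =
        numPartitionsInBox b δ n) ∧
    (b = 0 →
      kroneckerCoeff ℂ (Nat.Partition.rectangle n δ) (Nat.Partition.rectangle n δ)
          (Nat.Partition.twoRow (n * δ) b (by omega)) = 1)

/-- **BLMW 2011 §8.3, "Proposition 8.1" (the case `n = 2`, from [arXiv:0809.3710]):** "A Kronecker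
coefficient `k_{π,(δδ),(δδ)}` is non-zero if and only if: either `π` is an even partition of `2δ`, of
length at most four, or `π` is an odd partition of `2δ`, of length exactly four. In both cases
`k_{π,(δδ),(δδ)} = 1`." ("even (respectively odd) if all its parts are even (respectively odd)".)
Named fact (D-0014), over `ℂ`. (v1: Prop. 8.1, held p0018–p0019.) [cite: BurgisserEtAl2011, §8.3 Prop. 8.1] -/
def BLMW2011_prop_8_1 : Prop :=
  ∀ (δ : ℕ) (π : Nat.Partition (2 * δ)),
    (kroneckerCoeff ℂ (Nat.Partition.rectangle 2 δ) (Nat.Partition.rectangle 2 δ) π ≠ 0 ↔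
      ((∀ x ∈ π.parts, Even x) ∧ π.parts.card ≤ 4) ∨ ((∀ x ∈ π.parts, Odd x) ∧ π.parts.card = 4)) ∧
    (kroneckerCoeff ℂ (Nat.Partition.rectangle 2 δ) (Nat.Partition.rectangle 2 δ) π ≠ 0 →
      kroneckerCoeff ℂ (Nat.Partition.rectangle 2 δ) (Nat.Partition.rectangle 2 δ) π = 1)

/-- **BLMW 2011 §8.3, "Constraints":** "Let `[π]` be a component of `[(δⁿ)] ⊗ [(δⁿ)]`. The entropy
relations (8.2.2) yield `H(π̃) ≤ 2 log(n)`. Denote `|π|_{≤a} = π₁ + ⋯ + π_a` (and similarly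
`|π|_{>a}`). Then [Manivel 1997, Théorème 3.2] gives `|π|_{>ab} ≤ δ(n-a)⁺ + δ(n-b)⁺` where
`x⁺ = x` if `x` is positive and zero otherwise. For example `|π|_{≤n} ≥ δ`." Entropy in bits
(the tree's `partitionEntropy`, base 2, so `2 log₂ n`); `(·)⁺` is truncated subtraction in `ℕ`;
parts in decreasing order `π.sortedParts`; `n = dim V ≥ 1` as throughout §8.3 of the print
(`V = ℂⁿ` carries the rectangle `δⁿ`), carried as the hypothesis `0 < n`. ERRATUM of the first
landing of this file: the hypothesis `0 < n` was omitted, and the statement so typed is false at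
`n = 0`, `δ ≥ 1` (all three partitions are then `∅ ⊢ 0`, `k_{∅∅∅} = 1`, while the third conjunct
reads `δ ≤ 0`; val-lit t02, 2026-08-26) — corrected here; conjuncts 1–2 hold for all `n`. PROVED
in the sibling file `BLMW11KroneckerConstraintsProofs.lean` (`BLMW2011_rectangular_constraints_of_pos`,
from the tree's Ikenmeyer–Mulmuley–Walter point-set criterion and the CVZ entropy inequality).
Named fact (D-0014), over `ℂ`. (v1: §8.3 "Constraints", held p0019.)
[cite: BurgisserEtAl2011, §8.3 (Constraints)] -/
def BLMW2011_rectangular_constraints : Prop :=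
  ∀ (n δ : ℕ) (π : Nat.Partition (n * δ)), 0 < n →
    kroneckerCoeff ℂ (Nat.Partition.rectangle n δ) (Nat.Partition.rectangle n δ) π ≠ 0 →
      partitionEntropy π ≤ 2 * Real.logb 2 n ∧
      (∀ a b : ℕ, (π.sortedParts.drop (a * b)).sum ≤ δ * (n - a) + δ * (n - b)) ∧
      δ ≤ (π.sortedParts.take n).sum

end Rectangular

/-! ### §8.4 The zero weight space and Cor. 8.4.2 -/

section ZeroWeight

variable (k : Type*) [Field k] (n : ℕ)

/-- Permutation matrices as elements of `GL_n(k)` (Mathlib's `Matrix.permMatrixHom`, made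
unit-valued): the action of `𝔖_n` on `V = kⁿ` fixed by a basis, BLMW 2011 §8.4 ("fix a basis of
`V`. This defines an action of `𝔖_n` on `V`, and on any Schur power `S_μV`").
[cite: BurgisserEtAl2011, §8.4] -/
def permToGL : Equiv.Perm (Fin n) →* GL (Fin n) k :=
  (Matrix.permMatrixHom (n := Fin n) (R := k)).toHomUnits

variable {n} in
/-- **The zero weight space `(S_μV)_0` (BLMW 2011 §8.4):** "the zero-weight space `(S_μV)_0` …
non-trivial if and only if `μ` is of size `nδ` for some `δ`. Here zero-weight must be understood
with respect to a maximal torus in `SL(V)`" — i.e. the `GL_n`-weight space of the constant weight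
`(δ, …, δ)` in `S_μV` (`V = kⁿ`, `|μ| = nδ`; tree: `weightSpace` of `schurRep (stdRep (Fin n) k) μ`).
In §5.5 it is written `(S_μE)_0 := (S_μE)^{T_E}`. [cite: BurgisserEtAl2011, §8.4] -/
def zeroWeightSpace {D : ℕ} (μ : Nat.Partition D) (δ : ℕ) :=
  weightSpace (schurRep (stdRep (Fin n) k) μ) fun _ => (δ : ℤ)

variable {n} in
/-- `𝔖_n` acting on `S_μV` (`V = kⁿ`) through permutation matrices (BLMW 2011 §8.4: "This defines an
action of `𝔖_n` on `V`, and on any Schur power `S_μV`"). [cite: BurgisserEtAl2011, §8.4] -/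
def permSchurRep {D : ℕ} (μ : Nat.Partition D) :
    Representation k (Equiv.Perm (Fin n)) (schurModule k (Fin n → k) μ) :=
  (schurRep (stdRep (Fin n) k) μ).comp (permToGL k n)

variable {n} in
/-- The `𝔖_n`-invariants of the zero weight space, `(S_μV)_0^{𝔖_n}` (`𝔖_n` acting through
permutation matrices; the fixed vectors are written as `⨅_w eqLocus (w·) id`, i.e. Mathlib's
`Representation.invariants` spelled for the submodule carrier), whose dimension is BLMW's `p_μ`
(§5.5). [cite: BurgisserEtAl2011, §5.5 (p_μ)] -/
def zeroWeightInvariants {D : ℕ} (μ : Nat.Partition D) (δ : ℕ) :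
    Submodule k (schurModule k (Fin n → k) μ) :=
  zeroWeightSpace k (n := n) μ δ ⊓
    ⨅ w : Equiv.Perm (Fin n), LinearMap.eqLocus (permSchurRep k (n := n) μ w) LinearMap.id

/-- **BLMW 2011, Cor. 8.4.2 (of Gay's Thm. 8.4.1):** "Let `μ` be a partition of size `nδ`. The
dimension of the space of `𝔖_n`-invariants in the zero weight space `(S_μℂⁿ)_0` equals the
multiplicity of `S_μℂⁿ` in the plethysm `S^n(S^δℂⁿ)`." With the tree's
`plethysmCoeffOfPartition ℂ n δ μ` (multiplicity of `V(μ)` in `Sym^n(Sym^δ ℂⁿ)` for `μ ⊢ nδ` with at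
most `n` parts — the hypothesis `ℓ(μ) ≤ n` is implicit in print, `S_μℂⁿ = 0` otherwise; `δ ≥ 1`
excludes only the tree's documented junk value of `plethysmCoeff` at inner degree `0`).
Named fact (D-0014). (v1: Cor. 8.3, held p0019.) [cite: BurgisserEtAl2011, Cor. 8.4.2] -/
def BLMW2011_cor_8_4_2 : Prop :=
  ∀ (n δ : ℕ) (μ : Nat.Partition (n * δ)), 0 < δ → μ.parts.card ≤ n →
    Module.finrank ℂ (zeroWeightInvariants ℂ (n := n) μ δ) = plethysmCoeffOfPartition ℂ n δ μ

end ZeroWeight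

/-! ### §9.1 Weakly-skew and skew circuits -/

namespace ArithCircuit

variable {k : Type*} {σ : Type*}

/-- The gate references among the operands of a gate (the in-edges coming from computation
gates). [cite: BurgisserEtAl2011, §9.1] -/
def Gate.refs (g : Gate k σ) : List ℕ :=
  g.args.filterMap fun u => match u with
    | .gate j => some j
    | _ => none

/-- `P.References l j`: gate number `l` has gate `j` among its operands (an edge `j → l` of the
underlying graph). [cite: BurgisserEtAl2011, §9.1] -/
def References (P : ArithCircuit k σ) (l j : ℕ) : Prop :=
  ∃ g : Gate k σ, P.gates[l]? = some g ∧ j ∈ g.refs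

/-- The sub-circuit `C_j` below gate `j`: the gates from which `j` is reached, i.e. `j` itself and
everything it (transitively) references. [cite: BurgisserEtAl2011, §9.1 (the subcircuit C_α)] -/
def subcircuit (P : ArithCircuit k σ) (j : ℕ) : Set ℕ :=
  {l | Relation.ReflTransGen P.References j l}

/-- The operand `gate j` of gate number `i` is computed by a *separate* sub-circuit in the sense of
BLMW 2011 §9.1 (the edge from `C_j` to gate `i` is the unique edge leaving `C_j`): every gate outside
`C_j` references the gates of `C_j` zero times, except gate `i`, which references `j` exactly once and
no other gate of `C_j`. [cite: BurgisserEtAl2011, §9.1 (weakly-skew circuits)] -/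
def IsSeparateOperand (P : ArithCircuit k σ) (i j : ℕ) : Prop :=
  ∀ l : ℕ, l ∉ P.subcircuit j → ∀ g : Gate k σ, P.gates[l]? = some g →
    ∀ j' ∈ P.subcircuit j, g.refs.count j' = if l = i ∧ j' = j then 1 else 0

/-- **Weakly-skew circuit (BLMW 2011 §9.1; Malod–Portier):** "we require that for each
multiplication gate `α`, at least one of the two vertices pointing to `α` is computed by a separate
subcircuit `C_α`." In the straight-line model: every product gate with operands has an operand that
is an input (inputs are private vertices) or a gate reference computed by a separate sub-circuit.
Intended for fan-in-two circuits (`IsFanInTwo`), as in print. [cite: BurgisserEtAl2011, §9.1 (weakly-skew circuits)] -/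
def IsWeaklySkew (P : ArithCircuit k σ) : Prop :=
  ∀ (i : ℕ) (args : List (Operand k σ)), P.gates[i]? = some (.prod args) → args ≠ [] →
    ∃ u ∈ args, u.isGateRef = false ∨ ∃ j, u = .gate j ∧ P.IsSeparateOperand i j

end ArithCircuit

section WeaklySkew

variable {k : Type*} [CommSemiring k] {σ : Type*}

/-- **`L_ws(f)` (BLMW 2011 §9.1):** "Restricting to weakly-skew circuits … one defines the
corresponding complexity notion `L_ws(f)`" — the least size of a fan-in-two weakly-skew circuit
computing `f` (size = number of gates, the tree's `ArithCircuit.size`; BLMW count vertices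
including inputs — the two measures differ by a constant factor). `sInf` junk `0` on an empty set
(does not occur: the universal circuit of `ArithCircuit.exists_computes` can be taken skew).
The circuits are WELL-FORMED (`ArithCircuit.WellFormed`, Bürgisser 2000 Def. 2.1: a gate only
references earlier gates), so that `subcircuit j ⊆ {l ≤ j}` and `IsSeparateOperand` means what
§9.1 means. ERRATUM A14 (cell `val-lit`, 2026-08-26): AS TYPED BEFORE THE CORRECTION the set was
unguarded — with `ArithCircuit`'s junk value `0` for forward gate references, a `0`-weighted
forward-reference cycle through the sum gates makes every `subcircuit` total and
`IsSeparateOperand` vacuous, so every fan-in-two circuit counted as weakly skew (witness: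
repeated squaring, `L_ws(x^(2^n)) ≤ 2n` in the unguarded sense, whence conjunct (ii) of
`BLMW2011_sec9_detVPws` failed by a degree count — kernel-checked refutation of the unguarded
statement (repeated-squaring family, val-lit erratum A14, 2026-08-26)). AS CORRECTED: the printed
notion. [cite: BurgisserEtAl2011, §9.1 (L_ws)] -/
def wsComplexity (f : MvPolynomial σ k) : ℕ :=
  sInf {s | ∃ P : ArithCircuit k σ,
    P.WellFormed ∧ P.IsFanInTwo ∧ P.IsWeaklySkew ∧ P.Computes f ∧ P.size = s}

/-- The skew-circuit complexity (BLMW 2011 §9.4: "A skew arithmetic circuit is an arithmetic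
circuit such that for each multiplication gate `α` at least one of the two vertices pointing to `α`
is an input vertex" — the tree's `ArithCircuit.IsSkew`, `HI16BinaryDC.lean`): least size of a
fan-in-two WELL-FORMED skew circuit computing `f` (ERRATUM A14: the well-formedness guard
added together with `wsComplexity`'s, same reason). [cite: BurgisserEtAl2011, §9.4 (skew circuits)] -/
def skewComplexity (f : MvPolynomial σ k) : ℕ :=
  sInf {s | ∃ P : ArithCircuit k σ,
    P.WellFormed ∧ P.IsFanInTwo ∧ P.IsSkew ∧ P.Computes f ∧ P.size = s}

/-- Intro lemma for `L_ws` (so that no user unfolds the set): a well-formed fan-in-two weakly-skew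
circuit computing `f` bounds `L_ws(f)` by its size. [cite: BurgisserEtAl2011, §9.1 (L_ws)] -/
theorem wsComplexity_le_size {f : MvPolynomial σ k} (P : ArithCircuit k σ) (hwf : P.WellFormed)
    (h2 : P.IsFanInTwo) (hws : P.IsWeaklySkew) (hc : P.Computes f) :
    wsComplexity f ≤ P.size :=
  Nat.sInf_le ⟨P, hwf, h2, hws, hc, rfl⟩

/-- Intro lemma for the skew complexity: a well-formed fan-in-two skew circuit computing `f`
bounds it by its size. [cite: BurgisserEtAl2011, §9.4 (skew circuits)] -/
theorem skewComplexity_le_size {f : MvPolynomial σ k} (P : ArithCircuit k σ) (hwf : P.WellFormed)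
    (h2 : P.IsFanInTwo) (hsk : P.IsSkew) (hc : P.Computes f) :
    skewComplexity f ≤ P.size :=
  Nat.sInf_le ⟨P, hwf, h2, hsk, hc, rfl⟩

/-- Attainment lemma for `L_ws` (elimination form, so that no user unfolds the set): if some
well-formed fan-in-two weakly-skew circuit computes `f`, one of size exactly `L_ws(f)` does.
[cite: BurgisserEtAl2011, §9.1 (L_ws)] -/
theorem exists_size_eq_wsComplexity {f : MvPolynomial σ k}
    (h : ∃ P : ArithCircuit k σ, P.WellFormed ∧ P.IsFanInTwo ∧ P.IsWeaklySkew ∧ P.Computes f) :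
    ∃ P : ArithCircuit k σ, P.WellFormed ∧ P.IsFanInTwo ∧ P.IsWeaklySkew ∧ P.Computes f ∧
      P.size = wsComplexity f := by
  obtain ⟨P, hwf, h2, hws, hc⟩ := h
  exact Nat.sInf_mem (s := {s | ∃ P : ArithCircuit k σ,
    P.WellFormed ∧ P.IsFanInTwo ∧ P.IsWeaklySkew ∧ P.Computes f ∧ P.size = s})
    ⟨P.size, P, hwf, h2, hws, hc, rfl⟩

/-- Attainment lemma for the skew complexity (elimination form): if some well-formed fan-in-two
skew circuit computes `f`, one of size exactly `skewComplexity f` does.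
[cite: BurgisserEtAl2011, §9.4 (skew circuits)] -/
theorem exists_size_eq_skewComplexity {f : MvPolynomial σ k}
    (h : ∃ P : ArithCircuit k σ, P.WellFormed ∧ P.IsFanInTwo ∧ P.IsSkew ∧ P.Computes f) :
    ∃ P : ArithCircuit k σ, P.WellFormed ∧ P.IsFanInTwo ∧ P.IsSkew ∧ P.Computes f ∧
      P.size = skewComplexity f := by
  obtain ⟨P, hwf, h2, hsk, hc⟩ := h
  exact Nat.sInf_mem (s := {s | ∃ P : ArithCircuit k σ,
    P.WellFormed ∧ P.IsFanInTwo ∧ P.IsSkew ∧ P.Computes f ∧ P.size = s})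
    ⟨P.size, P, hwf, h2, hsk, hc, rfl⟩

/-- **`VP_ws` (BLMW 2011 §9.1):** "The set of sequences `(f_n)` such that `L_ws(f_n)` is
polynomially bounded in `n` comprises the complexity class `VP_ws`." (No separate degree bound:
"the degree of the polynomial computed by a weakly-skew circuit is bounded by its size".)
[cite: BurgisserEtAl2011, §9.1 (VP_ws)] -/
def IsVPwsFamily {σ : ℕ → Type*} (f : ∀ n, MvPolynomial (σ n) k) : Prop :=
  IsPBounded fun n => wsComplexity (f n)

end WeaklySkew

/-- **BLMW 2011 §9.1–§9.2 and §9.4, facts about `VP_ws` (class-level, over `ℂ`):**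
(i) "Since `L_ws(det_n) = O(n⁵)` [Berkowitz], we have `(det_n) ∈ VP_ws`";
(ii) "the sequence `(det_n)` of determinants is `VP_ws`-complete [toda:92]" — by "the determinant
has the following important universality property: if `L_ws(f) ≤ m` then `f` is a projection of
`det_{m+1}`", every `VP_ws` family is a p-projection of `(det_n)` (typed for families indexed by
`Fin (v n)` variables, as the tree's `IsVNPComplete`);
(iii) (§9.4, [koka:08]) "For each weakly-skew circuit there exists a skew circuit with at most
double size that computes the same polynomial", typed as `skewComplexity f ≤ 2·wsComplexity f`
up to the constant relating the two size measures: `∃ c, ∀ f, skewComplexity f ≤ c * wsComplexity f`.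
The exact constants of print (`m + 1`, `2`) refer to BLMW's vertex count and are NOT asserted for
the tree's gate count. Named fact (D-0014). (v1: §9.1–§9.2, §9.4, held p0020–p0022.)
[cite: BurgisserEtAl2011, §9.1–§9.2 (det ∈ VP_ws, VP_ws-completeness), §9.4 (skew vs weakly-skew)] -/
def BLMW2011_sec9_detVPws : Prop :=
  IsVPwsFamily (fun n => detPoly (Fin n) ℂ) ∧
  (∀ (v : ℕ → ℕ) (f : ∀ n, MvPolynomial (Fin (v n)) ℂ), IsVPwsFamily f →
    IsPProjection f fun n => detPoly (Fin n) ℂ) ∧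
  ∃ c : ℕ, ∀ {σ : Type} [Fintype σ] (f : MvPolynomial σ ℂ), skewComplexity f ≤ c * wsComplexity f

/-! ### §9.3 Approximate complexity classes -/

section Approximate

variable {σ : Type*} [Fintype σ] [DecidableEq σ]

/-- **BLMW 2011, Def. 9.3.1 (`\underline{L}`, [buer:03a]):** "The approximate complexity
`\underline{L}(f)` of `f ∈ A` is defined as the minimum `r ∈ ℕ` such that `f` is in the closure of
`{g ∈ A | L(g) ≤ r}`." Rendering: `A` is taken to be `ℂ[x_σ]` for the variables `σ` of `f`
(approximants in further variables can be specialised to `0` without increasing `L`), and the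
closure is the Zariski closure in coefficient space (the tree's `zariskiClosure`/`coeffVec`) —
"the same complexity notions are obtained when using the Zariski topology, since constructible
sets have the same closure with respect to Euclidean and Zariski topology" (BLMW, after
Def. 9.3.1); `L` = the tree's `complexity`. `sInf` junk `0` on an empty set (does not occur:
`r = L(f)` qualifies). (v1: Def. 9.1, held p0021.) [cite: BurgisserEtAl2011, Def. 9.3.1] -/
def approxComplexity (f : MvPolynomial σ ℂ) : ℕ :=
  sInf {r | coeffVec f ∈ zariskiClosure (coeffVec '' {g : MvPolynomial σ ℂ | complexity g ≤ r})}

/-- **`\underline{L_ws}(f)` (BLMW 2011, Def. 9.3.1):** "Replacing here `L(g)` by `L_ws(g)` we obtain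
the approximate complexity `\underline{L_ws}(f)`" (same rendering as `approxComplexity`).
[cite: BurgisserEtAl2011, Def. 9.3.1] -/
def approxWsComplexity (f : MvPolynomial σ ℂ) : ℕ :=
  sInf {r | coeffVec f ∈ zariskiClosure (coeffVec '' {g : MvPolynomial σ ℂ | wsComplexity g ≤ r})}

/-- **`\overline{VP_ws}` (BLMW 2011 §9.3):** "the set of sequences `(f_n)` of complex polynomials such
that `\underline{L_ws}(f_n)` is polynomially bounded in `n`." [cite: BurgisserEtAl2011, §9.3 (closure of VP_ws)] -/
def IsVPwsBarFamily {σ : ℕ → Type*} [∀ n, Fintype (σ n)] [∀ n, DecidableEq (σ n)]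
    (f : ∀ n, MvPolynomial (σ n) ℂ) : Prop :=
  IsPBounded fun n => approxWsComplexity (f n)

/-- **`\overline{VP}` (BLMW 2011 §9.3):** "Similarly, one defines the classes `\overline{VP}`" —
sequences with `\underline{L}(f_n)` polynomially bounded. [cite: BurgisserEtAl2011, §9.3 (closure of VP)] -/
def IsVPBarFamily {σ : ℕ → Type*} [∀ n, Fintype (σ n)] [∀ n, DecidableEq (σ n)]
    (f : ∀ n, MvPolynomial (σ n) ℂ) : Prop :=
  IsPBounded fun n => approxComplexity (f n)

end Approximate

/-- **BLMW 2011, Prop. 9.3.2:** "[Statement] 1.1 [MS1] is equivalent to `(per_m) ∉ \overline{VP_ws}`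
and equivalent to `VNP ⊄ \overline{VP_ws}`", where statement 1.1 of BLMW's introduction ("there is no
constant `c ≥ 1` such that for sufficiently large `m`,
`\overline{GL_{m^{2c}}·ℓ^{m^c-m}per_m} ⊂ \overline{GL_{m^{2c}}·det_{m^c}}`") is the tree's
`BorderDcPerSuperpolynomial` (`GCT.lean`, registered there with BLMW's §1 locator); `(per_m)` = the
family `perPoly (Fin m) ℂ`; `VNP ⊄ \overline{VP_ws}` = some `VNP` family (variables `Fin (v n)`, as
in the tree's `IsVNPComplete`) is not in `\overline{VP_ws}`. This is a PROVED equivalence of the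
source (a theorem relating two statements, asserting neither side), vendored as a named fact
(D-0014). (v1: Prop. 9.2, held p0021.) [cite: BurgisserEtAl2011, Prop. 9.3.2] -/
def BLMW2011_prop_9_3_2 : Prop :=
  (BorderDcPerSuperpolynomial ↔ ¬ IsVPwsBarFamily fun m => perPoly (Fin m) ℂ) ∧
  (BorderDcPerSuperpolynomial ↔
    ¬ ∀ (v : ℕ → ℕ) (f : ∀ n, MvPolynomial (Fin (v n)) ℂ), IsVNPFamily f → IsVPwsBarFamily f)

/-! ### §9.4 Order of approximation -/

section OrderOfApproximation

/-- **BLMW 2011, Lemma 9.4.1 (Hilbert 1893; Kraft III.2.3 Lemma 1):** "Let `R = ℂ[[ε]]` … and `K`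
its quotient field. … Suppose that `f` lies in the `GL_N(ℂ)`-orbit closure of `g ∈ S^nℂ^N`. Then
there exists `σ ∈ GL_N(K)` such that `F := σ·g ∈ S^nR^N` satisfies `(F)_{ε=0} = f`." Typed with
`K = LaurentSeries ℂ`, `R = PowerSeries ℂ`, `σ` a matrix over `K` with unit determinant acting by
the tree's `linSubst` on `g ⊗ K`, `F` a polynomial with coefficients in `R`, `(F)_{ε=0}` =
`map constantCoeff F`; `f ∈ \overline{GL_N(ℂ)·g}` = the tree's `orbitClosure`. Named fact (D-0014).
(v1: Lemma 9.4, held p0022.) [cite: BurgisserEtAl2011, Lemma 9.4.1] -/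
def BLMW2011_lemma_9_4_1 : Prop :=
  ∀ {N : ℕ} (f g : MvPolynomial (Fin N) ℂ), f ∈ orbitClosure g →
    ∃ (A : Matrix (Fin N) (Fin N) (LaurentSeries ℂ)) (F : MvPolynomial (Fin N) (PowerSeries ℂ)),
      IsUnit A.det ∧
      linSubst (Fin N) (LaurentSeries ℂ) A (MvPolynomial.map (algebraMap ℂ (LaurentSeries ℂ)) g) =
        MvPolynomial.map (algebraMap (PowerSeries ℂ) (LaurentSeries ℂ)) F ∧
      MvPolynomial.map PowerSeries.constantCoeff F = f

/-- **"`f` can be approximated with order at most `q` along a curve in the orbit of `g`"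
(BLMW 2011, (9.4.1)):** "we get `R`-linear forms `y_1, …, y_N` such that
`g(y_1, …, y_N) = ε^q f + ε^{q+1} F̃` with some `q ∈ ℕ` and `F̃ ∈ S^nR^N`." Typed: there is a matrix
`A` over `R = ℂ[[ε]]` (the coefficients of the `y_i`; not required invertible, as in print) and `F̃`
with `A · (g ⊗ R) = ε^q (f ⊗ R) + ε^{q+1} F̃`. [cite: BurgisserEtAl2011, §9.4 (9.4.1)] -/
def IsApproxAlongOrbitOfOrder {N : ℕ} (g f : MvPolynomial (Fin N) ℂ) (q : ℕ) : Prop :=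
  ∃ (A : Matrix (Fin N) (Fin N) (PowerSeries ℂ)) (F : MvPolynomial (Fin N) (PowerSeries ℂ)),
    linSubst (Fin N) (PowerSeries ℂ) A (MvPolynomial.map (algebraMap ℂ (PowerSeries ℂ)) g) =
      C (PowerSeries.X ^ q) * MvPolynomial.map (algebraMap ℂ (PowerSeries ℂ)) f +
        C (PowerSeries.X ^ (q + 1)) * F

/-- **BLMW 2011, Question 9.4.2 — OPEN QUESTION, stated neutrally, never asserted:** "Suppose that
`f` lies in orbit closure of `det_n` in `S^nℂ^{n²}`. Can the order of approximation of `f` along a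
curve in the orbit of `det_n` be bounded by a polynomial in `n`?" Typed as the `Prop` "there is `c`
such that every `f ∈ \overline{GL_{n²}·det_n}` (all `n`) is approximated with order at most `n^c + c`
along a curve in the orbit of `det_n`" (`det_n` on the `n²` letters `Fin (n·n)` via the tree's
`detPoly` renamed along `finProdFinEquiv`). "[buer:03a, Thm. 5.7] proves an exponential upper bound
… in a more general situation." [cite: BurgisserEtAl2011, Question 9.4.2] [status: open question of the source] -/
def BLMW2011_question_9_4_2 : Prop :=
  ∃ c : ℕ, ∀ (n : ℕ) (f : MvPolynomial (Fin (n * n)) ℂ),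
    f ∈ orbitClosure (rename finProdFinEquiv (detPoly (Fin n) ℂ)) →
      ∃ q ≤ n ^ c + c, IsApproxAlongOrbitOfOrder (rename finProdFinEquiv (detPoly (Fin n) ℂ)) f q

/-- **BLMW 2011, Prop. 9.4.3:** "If Question 9.4.2 has an affirmative answer, then
`VP_ws = \overline{VP_ws}`." (The inclusion `VP_ws ⊆ \overline{VP_ws}` being trivial, the content is
`\overline{VP_ws} ⊆ VP_ws`; typed for families in variables `Fin (v n)`.) "In the present form, this
observation is new." Named fact (D-0014). (v1: Prop. 9.6, held p0022.) [cite: BurgisserEtAl2011, Prop. 9.4.3] -/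
def BLMW2011_prop_9_4_3 : Prop :=
  BLMW2011_question_9_4_2 →
    ∀ (v : ℕ → ℕ) (f : ∀ n, MvPolynomial (Fin (v n)) ℂ), IsVPwsBarFamily f ↔ IsVPwsFamily f

end OrderOfApproximation

/-! ### Elementary inclusions of §9.3 (proved) -/

section Inclusions

variable {σ : Type*}

/-- `\underline{L_ws}(f) ≤ L_ws(f)`: `f` itself lies in `{g | L_ws(g) ≤ L_ws(f)}`, hence in its
closure (BLMW 2011 §9.3, the inclusion `VP_ws ⊆ \overline{VP_ws}` underlying "we now discuss whether
approximation is actually necessary", §9.4). [cite: BurgisserEtAl2011, §9.3–§9.4 (VP_ws ⊆ closure)] -/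
theorem approxWsComplexity_le_wsComplexity (f : MvPolynomial σ ℂ) :
    approxWsComplexity f ≤ wsComplexity f :=
  Nat.sInf_le (subset_zariskiClosure _
    ⟨f, show wsComplexity f ≤ wsComplexity f from le_rfl, rfl⟩)

/-- `\underline{L}(f) ≤ L(f)` (BLMW 2011 §9.3, Def. 9.3.1: `f` lies in the closure of
`{g | L(g) ≤ L(f)}`). [cite: BurgisserEtAl2011, Def. 9.3.1] -/
theorem approxComplexity_le_complexity (f : MvPolynomial σ ℂ) :
    approxComplexity f ≤ complexity f :=
  Nat.sInf_le (subset_zariskiClosure _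
    ⟨f, show complexity f ≤ complexity f from le_rfl, rfl⟩)

/-- **`VP_ws ⊆ \overline{VP_ws}`** (BLMW 2011 §9.3–§9.4; the trivial half of Prop. 9.4.3's
`VP_ws = \overline{VP_ws}`). [cite: BurgisserEtAl2011, §9.3–§9.4 (VP_ws ⊆ closure)] -/
theorem IsVPwsFamily.isVPwsBarFamily {σ : ℕ → Type*} [∀ n, Fintype (σ n)] [∀ n, DecidableEq (σ n)]
    {f : ∀ n, MvPolynomial (σ n) ℂ} (hf : IsVPwsFamily f) : IsVPwsBarFamily f := by
  obtain ⟨c, hc⟩ := hf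
  exact ⟨c, fun n => (approxWsComplexity_le_wsComplexity (f n)).trans (hc n)⟩

end Inclusions

end Literature.Computability.AlgebraicComplexity
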